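import Summits.ABC.IUTFork.Cor312ProvKIdeles
import Summits.ABC.IUTFork.Thm311ToCor312
import Summits.ABC.IUTFork.Cor312PilotIdelesPrCapstone
import Summits.ABC.IUTFork.Cor312ProvenanceGenuine
import Summits.ABC.ABC.Theorems.IUTThetaPilotThetaPartIIULineCapstone
import HarnessLib

/-!
# Branch C certificate v5-L: the (xi-f) LICENCE at the genuine real setting OVER `K` ⟹ `ABC` — the leanest honest form
# (no region reading `ρ`, no q-datum `qK`, no q-pin, no lattice columns; q-number discharged; side conditions satisfiable at every datum)

C scoreboard, companion v5-L (`abc_of_licence_v5K`): LIC 1 · FACT 0 · CONE 1 (`hreg`) · READ 1 (`hΘ` one-sided) · SIDE 5 = 8 (explicit) / EFFECTIVE: tool line on STATUS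
ANTECEDENT (side conditions): SATISFIABLE at every genuine datum (`Cor312Prov.exists_realising_{q,theta}Ideles_pilotDataOfK`, p434704).
Reference: v5 `abc_of_SH_v5K` (p434856): per datum S_H 1 · PIN 1 · READ 1 · SIDE 5 + CONE 1 = 9 / EFFECTIVE 16.

PROOF-ONLY companion (no `def`, no new `Prop`) by the INTAKE seat abc-iut-C-cert-3 of its v5 (`Conditional/AbcOfSGenuineK.lean`, p434856; repair R1
of FINDING C-cert-3-F1, C-lead ruling C-R16 (b)). Under the q-pin the hull-level line S_H := `Cor312Vol.PilotKummerCompatHull` IS abc-iut-c312-1's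
(xi-f) licence `Thm311ToCor312.Licence P` («at every label of `𝔽_l^⋇` the q-pilot's region lies in the holomorphic hull `ⁿ˒°𝒰` of the union of
the possible images of the Θ-pilot», [IUTchIII] Cor. 3.12 Step (xi-f) p. 184; `Cor312Vol.licence_of_pilotKummerCompatHull`), and the licence is a
predicate of the SETTING alone (`Cor312.Setting` over a `Thm311.Situation`). So the certificate can be stated WITHOUT PR-1's region reading `ρ`,
WITHOUT the q-datum `qK` and the q-pin, and WITHOUT the typed lattice columns of Thm. 3.11 (`LatticeSituation`) — over abc-iut-c312-1's situation
`Real.situationPrVol` and abc-iut-c312-7's `Real.settingPrVolSharp` at the CONSTRUCTED `K`-level pilot datum `Cor312Prov.pilotDataOfK D K`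
(p434046). Everything else is as in v5: the q-number DISCHARGED by base-change invariance (`Cor312Prov.absLogq_eq_ndeg_qPilot_pilotDataOfK` ∘
c312-7 `negLogQ_settingPrVolSharp` ∘ c312-8 `negAbsLogQ_eq_neg_absLogq_of_isVolumeInputOf`), `BridgeHyps`/`ThetaFinite` theorems
(`bridgeHyps_settingPrVolSharp_of_ideles`, p424856), the side conditions (ideles non-zero / units off `S`; q-ideles REALISING `P_q` in `K_w`)
SATISFIABLE at every genuine datum ([IUTchI] Ex. 3.2 (iv) as the theorem `Cor312Prov.twoMulLDvdOrdq_pilotDataOfK`, p434704), the S-layer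
CONE binder `hreg` (abc-iut-c312-8 `ThetaPartII.ABC_of_cor312_of_hullRegime`, p428563).

PER DATUM (explicit `Prop` binders of `GenuineK.cor312Of_of_licence`): [LIC] `hLic : Thm311ToCor312.Licence P` · [READ] `hΘ` (ONE-SIDED: the
setting's verbatim `−|log(Θ)| ≤` the datum's defined `−|log(Θ)|` — OPEN, owners c312-7 / S7 / S3) · [SIDE] `htq0 htq1 ht0 ht1 htq`. So the
kernel's sentence for branch C at the genuine `K`-level data reads: **«`ABC` follows from: the (xi-f) licence at the assembled real setting of
every genuine Θ-datum over `K`, the one-sided Θ-volume identification there, and the hull-volume estimate at non-slot-constant data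
(RISK ¶7)»** — the licence being exactly the adjudication object (E3, C-R15: REFUTED at DEEP packets in radii form, p432372; at shallow data it
stands or falls with the typed Θ-side inequality). No side taken on [IUTchIII] Cor. 3.12 or any author; the licence is an assumption label;
typed ≠ proved; instantiated ≠ endorsed. [claim: Mochizuki2012, status: disputed]
[cite: Mochizuki2012, IUTchI Def. 3.1 (b),(c) pp. 61–62, Ex. 3.2 (iv) p. 71; IUTchIII Cor. 3.12 Step (xi-f) p. 184; IUTchIV Thm. 1.10 p. 23] [cite: DupuyHilado2025, §3.3–§3.4]
-/

noncomputable section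

open Set Function NumberField IsDedekindDomain

namespace Summit.ABC.IUTFork.Conditional

open Thm311 Thm311.Real Cor312 Cor312Vol Cor312Prov Literature.IUT.LogThetaLattice Literature.IUT.LogVolume
  Literature.IUT.HodgeTheaters Literature.IUT.LogVolume.ThetaData

/-! ## §1. One datum over an extension `L ⊇ F`: `I.Cor312Of` from the LICENCE + Θ-side identification + side conditions -/

section PerDatum

variable {F K Fbar : Type} [Field F] [NumberField F] [Field K] [NumberField K] [Algebra F K] [Field Fbar]
  [Algebra F Fbar] [Algebra K Fbar] {E : WeierstrassCurve F} [E.IsElliptic] {l : ℕ} {Pb : BadPlacePredicates K}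
  (D : InitialThetaData F K Fbar E l Pb) {I : ThetaVolumeInput (fieldOfModuli E) K}
  (L : Type) [Field L] [NumberField L] [Algebra F L] (M : Type) [Field M] [NumberField M]
  (archPk : ∀ (j : (thetaIndex (pilotDataOfK D L)).Label) (vQ : (thetaIndex (pilotDataOfK D L)).VQ),
    Set ((logShellsDH (pilotDataOfK D L) (analyticLogv L)).Packet j vQ))
  (archSub : ∀ (j : (thetaIndex (pilotDataOfK D L)).Label) (v : (thetaIndex (pilotDataOfK D L)).V),
    Set ((logShellsDH (pilotDataOfK D L) (analyticLogv L)).Packet j ((thetaIndex (pilotDataOfK D L)).over v)))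
  (Ψ : ℤ → ∀ v : (thetaIndex (pilotDataOfK D L)).V, v ∈ (thetaIndex (pilotDataOfK D L)).Vbad →
    Set ((logShellsDH (pilotDataOfK D L) (analyticLogv L)).StarPacket v))
  (act : ℤ → ∀ v : (thetaIndex (pilotDataOfK D L)).V, v ∈ (thetaIndex (pilotDataOfK D L)).Vbad →
    (logShellsDH (pilotDataOfK D L) (analyticLogv L)).StarPacket v →
      Module.End ℚ ((logShellsDH (pilotDataOfK D L) (analyticLogv L)).StarPacket v))
  (Mmod : ℤ → ∀ j : (thetaIndex (pilotDataOfK D L)).LabelStar, Set ((logShellsDH (pilotDataOfK D L) (analyticLogv L)).GlobalPacket j.1))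
  (region : ℤ → ∀ j : (thetaIndex (pilotDataOfK D L)).LabelStar, FinDivisor M → ∀ vQ : (thetaIndex (pilotDataOfK D L)).VQ,
    Set ((logShellsDH (pilotDataOfK D L) (analyticLogv L)).Packet j.1 vQ))
  (n : ℤ) {HT : Type} {LogLink : HT → HT → Type} {IsFull : ∀ {s t : HT}, LogLink s t → Prop}
  (lat : LGPGaussianLogThetaLattice LogLink IsFull)
  {Frd : Type} {IsoF : Frd → Frd → Type} {Ob : Frd → Type} {realify : Frd → Frd} {Strip : Type}
  {IsoS : Strip → Strip → Type} {Mv : ∀ v : (thetaIndex (pilotDataOfK D L)).V, v ∈ (thetaIndex (pilotDataOfK D L)).Vbad → Type}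
  [∀ v h, Monoid (Mv v h)]
  (sig : GlobalLGPFrobenioidSignature (thetaIndex (pilotDataOfK D L)).lstar (thetaIndex (pilotDataOfK D L)).V
    (· ∈ (thetaIndex (pilotDataOfK D L)).Vbad) Frd IsoF Ob realify Strip IsoS Mv)
  (split : SplittingMonoids Mv) {ObΔ : Type} {N : ∀ v : (thetaIndex (pilotDataOfK D L)).V, v ∈ (thetaIndex (pilotDataOfK D L)).Vbad → Type}
  [∀ v h, Monoid (N v h)] (qData : QPilotData ObΔ N)
  (t : ∀ (pp : Nat.Primes) (_ : Fin (pilotDataOfK D L).lstar) (x : (thetaIndex (pilotDataOfK D L)).Fibre (.inr pp)),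
    haveI : Fact (pp : ℕ).Prime := ⟨pp.2⟩; kOf (pilotDataOfK D L) pp.1 x)
  (tq : ∀ (pp : Nat.Primes) (x : (thetaIndex (pilotDataOfK D L)).Fibre (.inr pp)),
    haveI : Fact (pp : ℕ).Prime := ⟨pp.2⟩; kOf (pilotDataOfK D L) pp.1 x)

/-- **One datum, genuine real setting OVER `L ⊇ F` at the constructed pilot datum, LICENCE form: `I.Cor312Of` FROM the (xi-f) licence of the
setting, the one-sided Θ-side identification and the side conditions.** No region reading, no q-pin, no lattice columns. Route: c312-7
`bridgeHyps_settingPrVolSharp_of_ideles` + c312-1 `Thm311ToCor312.statement_of_licence` ⟹ the verbatim `Statement`; q-side by base-change invariance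
(`absLogq_eq_ndeg_qPilot_pilotDataOfK`) and provenance; Θ-side by `hΘ`. «`I.Cor312Of` follows from the licence + these hypotheses as typed, at these
data» — no side taken. [claim: Mochizuki2012, status: disputed] -/
theorem GenuineK.cor312Of_of_licence (hI : ThetaData.IsVolumeInputOf D I)
    (htq0 : ∀ pp x, tq pp x ≠ 0)
    (htq1 : ∀ (pp : Nat.Primes) (x : (thetaIndex (pilotDataOfK D L)).Fibre (.inr pp)),
      haveI : Fact (pp : ℕ).Prime := ⟨pp.2⟩; placeOf (pilotDataOfK D L) pp.1 x ∉ (pilotDataOfK D L).S → ‖tq pp x‖ = 1)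
    (ht0 : ∀ pp i x, t pp i x ≠ 0)
    (ht1 : ∀ (pp : Nat.Primes) (i : Fin (pilotDataOfK D L).lstar) (x : (thetaIndex (pilotDataOfK D L)).Fibre (.inr pp)),
      haveI : Fact (pp : ℕ).Prime := ⟨pp.2⟩; placeOf (pilotDataOfK D L) pp.1 x ∉ (pilotDataOfK D L).S → ‖t pp i x‖ = 1)
    (htq : ∀ (pp : Nat.Primes) (x : (thetaIndex (pilotDataOfK D L)).Fibre (.inr pp)),
      haveI : Fact (pp : ℕ).Prime := ⟨pp.2⟩
      Real.log ‖tq pp x‖ = -((pilotDataOfK D L).qPilot (placeOf (pilotDataOfK D L) pp.1 x)) * logNorm L (placeOf (pilotDataOfK D L) pp.1 x) /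
        localDegree L (placeOf (pilotDataOfK D L) pp.1 x))
    (hLic : Thm311ToCor312.Licence
      (settingPrVolSharp (pilotDataOfK D L) (logvAnalytic_analyticLogv (F := L)) M archPk archSub Ψ act Mmod region n lat sig split
        qData tq t htq0 htq1))
    (hΘ : (settingPrVolSharp (pilotDataOfK D L) (logvAnalytic_analyticLogv (F := L)) M archPk archSub Ψ act Mmod region n lat sig split
        qData tq t htq0 htq1).negLogTheta ≤
      ((I.negLogTheta : ℝ) : WithTop ℝ)) :
    I.Cor312Of := by
  have hst :
      (settingPrVolSharp (pilotDataOfK D L) (logvAnalytic_analyticLogv (F := L)) M archPk archSub Ψ act Mmod region n lat sig split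
        qData tq t htq0 htq1).Statement :=
    Thm311ToCor312.statement_of_licence
      (bridgeHyps_settingPrVolSharp_of_ideles (pilotDataOfK D L) (logvAnalytic_analyticLogv (F := L)) M archPk archSub Ψ act Mmod region n
        lat sig split qData t tq ht0 ht1 htq0 htq1)
      hLic
  have hq := negLogQ_settingPrVolSharp (pilotDataOfK D L) (logvAnalytic_analyticLogv (F := L)) M archPk archSub Ψ act Mmod region n lat sig
    split qData t tq htq0 htq1 htq
  rw [← absLogq_eq_ndeg_qPilot_pilotDataOfK D L] at hq
  obtain ⟨-, hle⟩ := hst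
  rw [hq] at hle
  show I.negAbsLogQ ≤ I.negLogTheta
  rw [Cor312Prov.negAbsLogQ_eq_neg_absLogq_of_isVolumeInputOf D hI]
  exact WithTop.coe_le_coe.mp (hle.trans hΘ)

end PerDatum

/-! ## §2. The apex: the LICENCE at the genuine setting over `K` of EVERY datum + the hull REGIME residue ⟹ `ABC` -/

section Family

open Literature.NumberTheory.DiophantineGeometry.GenEll Summit.ABC.ABC.Theorems

/-- **`abc_of_licence_v5K` (branch C, LICENCE form AT THE GENUINE REAL SETTING OVER `K`; per datum explicit LIC 1 · READ 1 · SIDE 5, plus the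
(P,l)-level CONE binder `hreg`).** `ABC` from, per `λ`-line point `P`, prime `l` and genuine Θ-volume datum `T`: DATA = the context binders of
abc-iut-c312-7's print-normalised real setting over the constructed `K`-level pilot datum `pilotDataOfK T.D T.K` (archimedean structures, line data,
lattice / Frobenioid-signature / splitting-monoid / q-pilot containers, Θ- and q-ideles) — no region reading, no q-datum, no columns, no pilot-data
or provenance binder; HYPOTHESES = [SIDE] `htq0 htq1 ht0 ht1 htq` (satisfiable at every datum, p434704) · [LIC] `hLic : Thm311ToCor312.Licence` of
the setting · [READ] `hΘ` one-sided · [CONE] `hreg`. «`ABC` follows from the licence + these hypotheses as typed, at these data» — no side taken on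
[IUTchIII] Cor. 3.12; typed ≠ proved; instantiated ≠ endorsed. [claim: Mochizuki2012, status: disputed] -/
theorem abc_of_licence_v5K
    (M : ∀ (P : NFPoint) (l : ℕ) (T : Cor22.ThetaVolumeDatumAt P l), Type) [∀ P l T, Field (M P l T)] [∀ P l T, NumberField (M P l T)]
    (archPk : ∀ (P : NFPoint) (l : ℕ) (T : Cor22.ThetaVolumeDatumAt P l), letI := T.instFieldF; letI := T.instNumberFieldF; letI := T.instAlgebraF; letI := T.instFieldK;
        letI := T.instNumberFieldK; letI := T.instAlgebraK; letI := T.instFieldFbar; letI := T.instAlgebraFbar;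
        letI := T.instAlgebraKFbar; letI := T.instIsElliptic;
      ∀ (j : (thetaIndex (pilotDataOfK T.D T.K)).Label) (vQ : (thetaIndex (pilotDataOfK T.D T.K)).VQ), Set ((logShellsDH (pilotDataOfK T.D T.K) (analyticLogv T.K)).Packet j vQ))
    (archSub : ∀ (P : NFPoint) (l : ℕ) (T : Cor22.ThetaVolumeDatumAt P l), letI := T.instFieldF; letI := T.instNumberFieldF; letI := T.instAlgebraF; letI := T.instFieldK;
        letI := T.instNumberFieldK; letI := T.instAlgebraK; letI := T.instFieldFbar; letI := T.instAlgebraFbar;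
        letI := T.instAlgebraKFbar; letI := T.instIsElliptic;
      ∀ (j : (thetaIndex (pilotDataOfK T.D T.K)).Label) (v : (thetaIndex (pilotDataOfK T.D T.K)).V), Set ((logShellsDH (pilotDataOfK T.D T.K) (analyticLogv T.K)).Packet j ((thetaIndex (pilotDataOfK T.D T.K)).over v)))
    (Ψ : ∀ (P : NFPoint) (l : ℕ) (T : Cor22.ThetaVolumeDatumAt P l), letI := T.instFieldF; letI := T.instNumberFieldF; letI := T.instAlgebraF; letI := T.instFieldK;
        letI := T.instNumberFieldK; letI := T.instAlgebraK; letI := T.instFieldFbar; letI := T.instAlgebraFbar;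
        letI := T.instAlgebraKFbar; letI := T.instIsElliptic;
      ℤ → ∀ v : (thetaIndex (pilotDataOfK T.D T.K)).V, v ∈ (thetaIndex (pilotDataOfK T.D T.K)).Vbad → Set ((logShellsDH (pilotDataOfK T.D T.K) (analyticLogv T.K)).StarPacket v))
    (act : ∀ (P : NFPoint) (l : ℕ) (T : Cor22.ThetaVolumeDatumAt P l), letI := T.instFieldF; letI := T.instNumberFieldF; letI := T.instAlgebraF; letI := T.instFieldK;
        letI := T.instNumberFieldK; letI := T.instAlgebraK; letI := T.instFieldFbar; letI := T.instAlgebraFbar;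
        letI := T.instAlgebraKFbar; letI := T.instIsElliptic;
      ℤ → ∀ v : (thetaIndex (pilotDataOfK T.D T.K)).V, v ∈ (thetaIndex (pilotDataOfK T.D T.K)).Vbad → (logShellsDH (pilotDataOfK T.D T.K) (analyticLogv T.K)).StarPacket v → Module.End ℚ ((logShellsDH (pilotDataOfK T.D T.K) (analyticLogv T.K)).StarPacket v))
    (Mmod : ∀ (P : NFPoint) (l : ℕ) (T : Cor22.ThetaVolumeDatumAt P l), letI := T.instFieldF; letI := T.instNumberFieldF; letI := T.instAlgebraF; letI := T.instFieldK;
        letI := T.instNumberFieldK; letI := T.instAlgebraK; letI := T.instFieldFbar; letI := T.instAlgebraFbar;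
        letI := T.instAlgebraKFbar; letI := T.instIsElliptic;
      ℤ → ∀ j : (thetaIndex (pilotDataOfK T.D T.K)).LabelStar, Set ((logShellsDH (pilotDataOfK T.D T.K) (analyticLogv T.K)).GlobalPacket j.1))
    (region : ∀ (P : NFPoint) (l : ℕ) (T : Cor22.ThetaVolumeDatumAt P l), letI := T.instFieldF; letI := T.instNumberFieldF; letI := T.instAlgebraF; letI := T.instFieldK;
        letI := T.instNumberFieldK; letI := T.instAlgebraK; letI := T.instFieldFbar; letI := T.instAlgebraFbar;
        letI := T.instAlgebraKFbar; letI := T.instIsElliptic;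
      ℤ → ∀ j : (thetaIndex (pilotDataOfK T.D T.K)).LabelStar, FinDivisor (M P l T) → ∀ vQ : (thetaIndex (pilotDataOfK T.D T.K)).VQ, Set ((logShellsDH (pilotDataOfK T.D T.K) (analyticLogv T.K)).Packet j.1 vQ))
    (n : ∀ (P : NFPoint) (l : ℕ) (T : Cor22.ThetaVolumeDatumAt P l), ℤ)
    {HT : ∀ (P : NFPoint) (l : ℕ) (T : Cor22.ThetaVolumeDatumAt P l), Type} {LogLink : ∀ (P : NFPoint) (l : ℕ) (T : Cor22.ThetaVolumeDatumAt P l), HT P l T → HT P l T → Type}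
    {IsFull : ∀ (P : NFPoint) (l : ℕ) (T : Cor22.ThetaVolumeDatumAt P l), ∀ {s t : HT P l T}, LogLink P l T s t → Prop}
    (lat : ∀ (P : NFPoint) (l : ℕ) (T : Cor22.ThetaVolumeDatumAt P l), LGPGaussianLogThetaLattice (LogLink P l T) (IsFull P l T))
    {Frd : ∀ (P : NFPoint) (l : ℕ) (T : Cor22.ThetaVolumeDatumAt P l), Type} {IsoF : ∀ (P : NFPoint) (l : ℕ) (T : Cor22.ThetaVolumeDatumAt P l), Frd P l T → Frd P l T → Type} {Ob : ∀ (P : NFPoint) (l : ℕ) (T : Cor22.ThetaVolumeDatumAt P l), Frd P l T → Type}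
    {realify : ∀ (P : NFPoint) (l : ℕ) (T : Cor22.ThetaVolumeDatumAt P l), Frd P l T → Frd P l T} {Strip : ∀ (P : NFPoint) (l : ℕ) (T : Cor22.ThetaVolumeDatumAt P l), Type} {IsoS : ∀ (P : NFPoint) (l : ℕ) (T : Cor22.ThetaVolumeDatumAt P l), Strip P l T → Strip P l T → Type}
    {Mv : ∀ (P : NFPoint) (l : ℕ) (T : Cor22.ThetaVolumeDatumAt P l), letI := T.instFieldF; letI := T.instNumberFieldF; letI := T.instAlgebraF; letI := T.instFieldK;
        letI := T.instNumberFieldK; letI := T.instAlgebraK; letI := T.instFieldFbar; letI := T.instAlgebraFbar;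
        letI := T.instAlgebraKFbar; letI := T.instIsElliptic;
      ∀ v : (thetaIndex (pilotDataOfK T.D T.K)).V, v ∈ (thetaIndex (pilotDataOfK T.D T.K)).Vbad → Type}
    [∀ P l T v h, Monoid (Mv P l T v h)]
    (sig : ∀ (P : NFPoint) (l : ℕ) (T : Cor22.ThetaVolumeDatumAt P l), letI := T.instFieldF; letI := T.instNumberFieldF; letI := T.instAlgebraF; letI := T.instFieldK;
        letI := T.instNumberFieldK; letI := T.instAlgebraK; letI := T.instFieldFbar; letI := T.instAlgebraFbar;
        letI := T.instAlgebraKFbar; letI := T.instIsElliptic;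
      GlobalLGPFrobenioidSignature (thetaIndex (pilotDataOfK T.D T.K)).lstar (thetaIndex (pilotDataOfK T.D T.K)).V (· ∈ (thetaIndex (pilotDataOfK T.D T.K)).Vbad) (Frd P l T) (IsoF P l T) (Ob P l T) (realify P l T)
        (Strip P l T) (IsoS P l T) (Mv P l T))
    (split : ∀ (P : NFPoint) (l : ℕ) (T : Cor22.ThetaVolumeDatumAt P l), SplittingMonoids (Mv P l T))
    {ObΔ : ∀ (P : NFPoint) (l : ℕ) (T : Cor22.ThetaVolumeDatumAt P l), Type} {N : ∀ (P : NFPoint) (l : ℕ) (T : Cor22.ThetaVolumeDatumAt P l), letI := T.instFieldF; letI := T.instNumberFieldF; letI := T.instAlgebraF; letI := T.instFieldK;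
        letI := T.instNumberFieldK; letI := T.instAlgebraK; letI := T.instFieldFbar; letI := T.instAlgebraFbar;
        letI := T.instAlgebraKFbar; letI := T.instIsElliptic;
      ∀ v : (thetaIndex (pilotDataOfK T.D T.K)).V, v ∈ (thetaIndex (pilotDataOfK T.D T.K)).Vbad → Type}
    [∀ P l T v h, Monoid (N P l T v h)] (qData : ∀ (P : NFPoint) (l : ℕ) (T : Cor22.ThetaVolumeDatumAt P l), QPilotData (ObΔ P l T) (N P l T))
    (t : ∀ (P : NFPoint) (l : ℕ) (T : Cor22.ThetaVolumeDatumAt P l), letI := T.instFieldF; letI := T.instNumberFieldF; letI := T.instAlgebraF; letI := T.instFieldK;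
        letI := T.instNumberFieldK; letI := T.instAlgebraK; letI := T.instFieldFbar; letI := T.instAlgebraFbar;
        letI := T.instAlgebraKFbar; letI := T.instIsElliptic;
      ∀ (pp : Nat.Primes) (_ : Fin (pilotDataOfK T.D T.K).lstar) (x : (thetaIndex (pilotDataOfK T.D T.K)).Fibre (.inr pp)), haveI : Fact (pp : ℕ).Prime := ⟨pp.2⟩; kOf (pilotDataOfK T.D T.K) pp.1 x)
    (tq : ∀ (P : NFPoint) (l : ℕ) (T : Cor22.ThetaVolumeDatumAt P l), letI := T.instFieldF; letI := T.instNumberFieldF; letI := T.instAlgebraF; letI := T.instFieldK;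
        letI := T.instNumberFieldK; letI := T.instAlgebraK; letI := T.instFieldFbar; letI := T.instAlgebraFbar;
        letI := T.instAlgebraKFbar; letI := T.instIsElliptic;
      ∀ (pp : Nat.Primes) (x : (thetaIndex (pilotDataOfK T.D T.K)).Fibre (.inr pp)), haveI : Fact (pp : ℕ).Prime := ⟨pp.2⟩; kOf (pilotDataOfK T.D T.K) pp.1 x)
    -- [SIDE] ideles non-zero, units off `S`; the q-ideles REALISE `P_q` in the completions of `K` (satisfiable at every datum, p434704)
    (htq0 : ∀ P l T pp x, tq P l T pp x ≠ 0)
    (htq1 : ∀ (P : NFPoint) (l : ℕ) (T : Cor22.ThetaVolumeDatumAt P l), letI := T.instFieldF; letI := T.instNumberFieldF; letI := T.instAlgebraF; letI := T.instFieldK;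
        letI := T.instNumberFieldK; letI := T.instAlgebraK; letI := T.instFieldFbar; letI := T.instAlgebraFbar;
        letI := T.instAlgebraKFbar; letI := T.instIsElliptic;
      ∀ (pp : Nat.Primes) (x : (thetaIndex (pilotDataOfK T.D T.K)).Fibre (.inr pp)),
        haveI : Fact (pp : ℕ).Prime := ⟨pp.2⟩; placeOf (pilotDataOfK T.D T.K) pp.1 x ∉ (pilotDataOfK T.D T.K).S → ‖tq P l T pp x‖ = 1)
    (ht0 : ∀ P l T pp i x, t P l T pp i x ≠ 0)
    (ht1 : ∀ (P : NFPoint) (l : ℕ) (T : Cor22.ThetaVolumeDatumAt P l), letI := T.instFieldF; letI := T.instNumberFieldF; letI := T.instAlgebraF; letI := T.instFieldK;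
        letI := T.instNumberFieldK; letI := T.instAlgebraK; letI := T.instFieldFbar; letI := T.instAlgebraFbar;
        letI := T.instAlgebraKFbar; letI := T.instIsElliptic;
      ∀ (pp : Nat.Primes) (i : Fin (pilotDataOfK T.D T.K).lstar) (x : (thetaIndex (pilotDataOfK T.D T.K)).Fibre (.inr pp)),
        haveI : Fact (pp : ℕ).Prime := ⟨pp.2⟩; placeOf (pilotDataOfK T.D T.K) pp.1 x ∉ (pilotDataOfK T.D T.K).S → ‖t P l T pp i x‖ = 1)
    (htq : ∀ (P : NFPoint) (l : ℕ) (T : Cor22.ThetaVolumeDatumAt P l), letI := T.instFieldF; letI := T.instNumberFieldF; letI := T.instAlgebraF; letI := T.instFieldK;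
        letI := T.instNumberFieldK; letI := T.instAlgebraK; letI := T.instFieldFbar; letI := T.instAlgebraFbar;
        letI := T.instAlgebraKFbar; letI := T.instIsElliptic;
      ∀ (pp : Nat.Primes) (x : (thetaIndex (pilotDataOfK T.D T.K)).Fibre (.inr pp)),
        haveI : Fact (pp : ℕ).Prime := ⟨pp.2⟩
        Real.log ‖tq P l T pp x‖ = -((pilotDataOfK T.D T.K).qPilot (placeOf (pilotDataOfK T.D T.K) pp.1 x)) * logNorm T.K (placeOf (pilotDataOfK T.D T.K) pp.1 x) /
          localDegree T.K (placeOf (pilotDataOfK T.D T.K) pp.1 x))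
    -- [LIC] the (xi-f) licence at the genuine setting over `K` of the datum — the adjudication object, an assumption label
    (hLic : ∀ (P : NFPoint) (l : ℕ) (T : Cor22.ThetaVolumeDatumAt P l), letI := T.instFieldF; letI := T.instNumberFieldF; letI := T.instAlgebraF; letI := T.instFieldK;
        letI := T.instNumberFieldK; letI := T.instAlgebraK; letI := T.instFieldFbar; letI := T.instAlgebraFbar;
        letI := T.instAlgebraKFbar; letI := T.instIsElliptic;
      Thm311ToCor312.Licence
        (settingPrVolSharp (pilotDataOfK T.D T.K) (logvAnalytic_analyticLogv (F := T.K)) (M P l T) (archPk P l T) (archSub P l T) (Ψ P l T)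
          (act P l T) (Mmod P l T) (region P l T) (n P l T) (lat P l T) (sig P l T) (split P l T) (qData P l T) (tq P l T)
          (t P l T) (htq0 P l T) (htq1 P l T)))
    -- [CONE] the hull-volume estimate with `B_III` for the NON-slot-constant data ONLY (c312-8 p428563's `hreg`, verbatim)
    (hreg : ∀ P : NFPoint, P ∈ UP → ∀ l : ℕ, l.Prime → 5 ≤ l →
      Cor22.AdmitsCore P → Cor22.CondP2 P l → Cor22.CondP5 P l → Cor22.CondP6 P l →
      ∀ T : Cor22.ThetaVolumeDatumAt P l,
        (letI := T.instFieldF; letI := T.instNumberFieldF; letI := T.instAlgebraF; letI := T.instFieldK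
         letI := T.instNumberFieldK; letI := T.instAlgebraK; letI := T.instFieldFbar; letI := T.instAlgebraFbar
         letI := T.instAlgebraKFbar; letI := T.instIsElliptic
         ¬ (∀ p ∈ T.I.supportPrimes, ∀ v w : placesOver (fieldOfModuli T.E) p,
            (Summit.ABC.IUTFork.DHData.ofInput T.I).logQloc p v = (Summit.ABC.IUTFork.DHData.ofInput T.I).logQloc p w)) →
        T.HullEstimateOf
          (((l : ℝ) + 1) / 4 *
            ((1 + 12 * (Cor22.dmod P : ℝ) / l) * (P.logDiff + Cor22.logCondAvoid P {2, l})
              + 2 * Real.log l + 52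
              + 20 / 3 * Real.log (((2 ^ 12 * 3 ^ 3 * 5 * Cor22.dmod P : ℕ) : ℝ) * (l : ℝ))
                * (Nat.primeCounting (2 ^ 12 * 3 ^ 3 * 5 * Cor22.dmod P * l) : ℝ))))
    -- [READ] the ONE-SIDED Θ-side identification
    (hΘ : ∀ (P : NFPoint) (l : ℕ) (T : Cor22.ThetaVolumeDatumAt P l), letI := T.instFieldF; letI := T.instNumberFieldF; letI := T.instAlgebraF; letI := T.instFieldK;
        letI := T.instNumberFieldK; letI := T.instAlgebraK; letI := T.instFieldFbar; letI := T.instAlgebraFbar;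
        letI := T.instAlgebraKFbar; letI := T.instIsElliptic;
      (settingPrVolSharp (pilotDataOfK T.D T.K) (logvAnalytic_analyticLogv (F := T.K)) (M P l T) (archPk P l T) (archSub P l T) (Ψ P l T)
          (act P l T) (Mmod P l T) (region P l T) (n P l T) (lat P l T) (sig P l T) (split P l T) (qData P l T) (tq P l T)
          (t P l T) (htq0 P l T) (htq1 P l T)).negLogTheta ≤ ((T.negLogTheta : ℝ) : WithTop ℝ)) :
    _root_.ABC := by
  have h312 : ∀ (P : NFPoint) (l : ℕ), Cor22.Cor312AtDatum P l := fun P l T => by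
    letI := T.instFieldF; letI := T.instNumberFieldF; letI := T.instAlgebraF; letI := T.instFieldK
    letI := T.instNumberFieldK; letI := T.instAlgebraK; letI := T.instFieldFbar; letI := T.instAlgebraFbar
    letI := T.instAlgebraKFbar; letI := T.instIsElliptic
    exact GenuineK.cor312Of_of_licence T.D T.K (M P l T) (archPk P l T) (archSub P l T) (Ψ P l T) (act P l T) (Mmod P l T)
      (region P l T) (n P l T) (lat P l T) (sig P l T) (split P l T) (qData P l T) (t P l T) (tq P l T)
      T.isVolumeInputOf (htq0 P l T) (htq1 P l T) (ht0 P l T) (ht1 P l T) (htq P l T) (hLic P l T) (hΘ P l T)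
  exact ThetaPartII.ABC_of_cor312_of_hullRegime (fun P _ l _ _ _ _ _ _ => h312 P l) hreg

end Family

end Summit.ABC.IUTFork.Conditional

end
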